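import Mathlib.LinearAlgebra.Matrix.Adjugate
import Mathlib.LinearAlgebra.Matrix.Trace
import Literature.Computability.AlgebraicComplexity.MignonRessayreBound
import HarnessLib

/-!
# Crux `GrenetZeon.TwoDimCoefficients` (stmt-ValiantsHypothesis-8062), line `dim2_cases` —
# the dual-number jet count: `rank H(tr(adj A · B))(0) ≤ 4m` at a singular point

Helper for the registered stub `stub_dualCase` (DUAL shape `per_n = α det A + β tr(adj A · B)`,
`R = ℂ[ε]/ε²`).  The line card budgets the Hessian rank of the `ε`-jet `tr(adj A · B)` at a common
zero of `per_n` and `det A` by a corank case analysis (`≤ 14m + O(1)`).  Here the count is done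
UNIFORMLY and elementarily, in the style of the tree's `rank_hess0_det_le`
(`Literature/Computability/AlgebraicComplexity/MignonRessayreBound.lean`):

* `trace_adjugate_mul`: `tr(adj A · B) = Σ_j det(A with row j replaced by row j of B)` (Laplace /
  Cramer: Mathlib's `cramer_transpose_apply`, `cramer_eq_adjugate_mulVec`), over any commutative ring.
* `rank_hess0_trace_adjugate_mul_le_of_row`: if `A`, `B` are square matrices of affine linear forms,
  the row `i₀` of `A` vanishes at the origin and `tr(adj A · B)(0) = 0`, then
  `rank H(tr(adj A · B))(0) ≤ 4m`: the summands `j ≠ i₀` expand along the row `i₀` of `A` into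
  `Σ_k A_{i₀k} · G_k` with `A_{i₀k}(0) = 0`, whose Hessian at `0` is a sum of `m` symmetrised rank-one
  matrices (`≤ 2m`); the summand `j = i₀` is the determinant of an affine matrix, and it vanishes at
  the origin because the other summands do and the total does — so `rank_hess0_det_le` gives `≤ 2m`.
* `rank_hess0_trace_adjugate_mul_le`: the general statement — `det A(0) = 0` and
  `tr(adj A · B)(0) = 0` imply `rank H(tr(adj A · B))(0) ≤ 4m` — by left-multiplying `A` and `B`
  with an invertible constant matrix `V` whose row `i₀` is a left null vector of `A(0)`
  (`tr(adj(VA) · VB) = det V · tr(adj A · B)`), exactly as in the tree proof of `rank_hess0_det_le`.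

Consequence used by `stub_dualCase`: at a common zero `p` of `per_n` and `det A` the Hessian of
`per_n = α det A + β tr(adj A · B)` has rank `≤ 2m + 4m = 6m`, so the codimension-two Hessian point
of `HessianRankCodimTwo` (`n² < 2 · rank`) forces `n² < 12m`.  HONEST FRAMING: an elementary rank
count serving an ASIDE item of a dormant-reactivated route; `VP ≠ VNP` is not moved by it.

References: T. Mignon, N. Ressayre, Int. Math. Res. Not. 2004:79, §2 (Hessian of `det` at a
singular point); J. M. Landsberg, *Geometry and Complexity Theory* (2017), Exercise 6.4.5.2
(behaviour under affine substitution).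
-/

-- single-conjunct layout `Summits/ValiantsHypothesis/ValiantsHypothesis`: the duplicated namespace
-- component is mandated by the tree.
set_option linter.dupNamespace false

noncomputable section

open MvPolynomial Matrix
open Literature.Computability.AlgebraicComplexity

namespace Summit.ValiantsHypothesis.ValiantsHypothesis.Theorems.GrenetZeonTwoDimCoefficients

/-! ### Jacobi's trace formula as a sum of row-replaced determinants -/

section Trace

variable {R : Type*} [CommRing R] {ι : Type*} [Fintype ι] [DecidableEq ι]

/-- `tr(adj A · B) = Σ_j det(A with row j replaced by row j of B)`: the `ε`-coefficient of
`det(A + εB)`, row by row (Laplace expansion along the replaced row). [folklore] -/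
theorem trace_adjugate_mul (A B : Matrix ι ι R) :
    (A.adjugate * B).trace = ∑ j, (A.updateRow j (B j)).det := by
  rw [Matrix.trace_mul_comm, Matrix.trace]
  refine Finset.sum_congr rfl fun j _ => ?_
  have h := congrFun (cramer_eq_adjugate_mulVec Aᵀ (B j)) j
  rw [cramer_transpose_apply, ← adjugate_transpose] at h
  rw [h, Matrix.diag_apply, Matrix.mul_apply, Matrix.mulVec, dotProduct]
  exact Finset.sum_congr rfl fun i _ => by rw [transpose_apply, mul_comm]

/-- Left multiplication by a constant matrix rescales the trace form:
`tr(adj(V A) · (V B)) = det V · tr(adj A · B)`. [folklore] -/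
theorem trace_adjugate_mul_mul_left (V A B : Matrix ι ι R) :
    ((V * A).adjugate * (V * B)).trace = V.det * (A.adjugate * B).trace := by
  rw [adjugate_mul_distrib, Matrix.mul_assoc, ← Matrix.mul_assoc V.adjugate, adjugate_mul,
    smul_mul, Matrix.one_mul, Matrix.mul_smul, trace_smul, smul_eq_mul]

end Trace

/-! ### Rank of the Hessian of `tr(adj A · B)` at the origin -/

section Rank

variable {K : Type*} [Field K] {σ : Type*} [Fintype σ]

/-- Two-summand rank subadditivity (from the tree's `rank_sum_le`). [folklore] -/
theorem rank_add_le {μ ν : Type*} [Fintype μ] [Fintype ν] (M N : Matrix μ ν K) :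
    (M + N).rank ≤ M.rank + N.rank := by
  have h := rank_sum_le (Finset.univ : Finset (Fin 2)) ![M, N]
  rw [Fin.sum_univ_two, Fin.sum_univ_two] at h
  simpa using h

/-- The Hessian at the origin of `ℓ · g` with `ℓ` affine and `ℓ(0) = 0` is the symmetrised rank-one
matrix `∇ℓ ∇g(0)ᵀ + ∇g(0) ∇ℓᵀ`, of rank `≤ 2`. [folklore] -/
theorem rank_hess0_mul_le_two {ℓ g : MvPolynomial σ K} (hdeg : ℓ.totalDegree ≤ 1)
    (hcc : constantCoeff ℓ = 0) : (hess0 (ℓ * g)).rank ≤ 2 := by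
  rw [hess0_mul, hess0_eq_zero_of_totalDegree_le_one hdeg, hcc, zero_smul, smul_zero, zero_add,
    zero_add]
  exact rank_vecMulVec_add_vecMulVec_le _ _ _ _

/-- **Row form.** Let `A`, `B` be `(n+1) × (n+1)` matrices over a polynomial ring with `A` affine,
the row `i₀` of `B` affine, the row `i₀` of `A` vanishing at the origin, and `tr(adj A · B)(0) = 0`.
Then `rank H(tr(adj A · B))(0) ≤ 4 (n + 1)`. [folklore] -/
theorem rank_hess0_trace_adjugate_mul_le_of_row {n : ℕ}
    (A B : Matrix (Fin (n + 1)) (Fin (n + 1)) (MvPolynomial σ K)) (i₀ : Fin (n + 1))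
    (hA : ∀ i j, (A i j).totalDegree ≤ 1) (hB : ∀ j, (B i₀ j).totalDegree ≤ 1)
    (hrow : ∀ j, constantCoeff (A i₀ j) = 0)
    (h0 : constantCoeff (A.adjugate * B).trace = 0) :
    (hess0 (A.adjugate * B).trace).rank ≤ 4 * (n + 1) := by
  classical
  -- the cofactor sums `G k` of the summands `j ≠ i₀`, expanded along the row `i₀`
  set G : Fin (n + 1) → MvPolynomial σ K := fun k =>
    ∑ j ∈ Finset.univ.erase i₀, (-1 : MvPolynomial σ K) ^ (i₀ + k : ℕ) *
      ((A.updateRow j (B j)).submatrix i₀.succAbove k.succAbove).det with hG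
  have hrest : ∑ j ∈ Finset.univ.erase i₀, (A.updateRow j (B j)).det =
      ∑ k, A i₀ k * G k := by
    have hexp : ∀ j ∈ Finset.univ.erase i₀, (A.updateRow j (B j)).det =
        ∑ k, A i₀ k * ((-1 : MvPolynomial σ K) ^ (i₀ + k : ℕ) *
          ((A.updateRow j (B j)).submatrix i₀.succAbove k.succAbove).det) := by
      intro j hj
      have hne : i₀ ≠ j := fun h => (Finset.ne_of_mem_erase hj) h.symm
      rw [Matrix.det_succ_row _ i₀]
      refine Finset.sum_congr rfl fun k _ => ?_
      rw [updateRow_ne hne]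
      ring
    rw [Finset.sum_congr rfl hexp, Finset.sum_comm]
    refine Finset.sum_congr rfl fun k _ => ?_
    rw [hG, Finset.mul_sum]
  have hsplit : (A.adjugate * B).trace =
      (A.updateRow i₀ (B i₀)).det + ∑ k, A i₀ k * G k := by
    rw [trace_adjugate_mul, ← Finset.add_sum_erase _ _ (Finset.mem_univ i₀), hrest]
  -- the row-replaced matrix at `j = i₀` is affine and its determinant vanishes at the origin
  have hCdeg : ∀ i j, (A.updateRow i₀ (B i₀) i j).totalDegree ≤ 1 := by
    intro i j
    by_cases hi : i = i₀
    · subst hi; rw [updateRow_self]; exact hB j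
    · rw [updateRow_ne hi]; exact hA i j
  have hCcc : constantCoeff (A.updateRow i₀ (B i₀)).det = 0 := by
    have h1 : constantCoeff (∑ k, A i₀ k * G k) = 0 := by
      rw [map_sum]
      exact Finset.sum_eq_zero fun k _ => by rw [map_mul, hrow k, zero_mul]
    have h2 := h0
    rw [hsplit, map_add, h1, add_zero] at h2
    exact h2
  -- assemble
  rw [hsplit, map_add]
  refine (rank_add_le _ _).trans ?_
  have hdet := rank_hess0_det_le (A.updateRow i₀ (B i₀)) hCdeg hCcc
  have hsum : (hess0 (∑ k, A i₀ k * G k)).rank ≤ 2 * (n + 1) := by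
    rw [map_sum]
    refine (rank_sum_le _ _).trans ?_
    refine (Finset.sum_le_sum fun k _ =>
      rank_hess0_mul_le_two ((hA i₀ k)) (hrow k)).trans ?_
    simp [mul_comm]
  omega

/-- **The dual jet count.** Let `A`, `B` be `m × m` matrices of affine linear forms over a field with
`det A(0) = 0` and `tr(adj A · B)(0) = 0`.  Then the Hessian of `tr(adj A · B)` at the origin has
rank `≤ 4m`.  (Left-normalise a row of `A` to vanish at the origin by an invertible constant matrix,
which rescales `tr(adj A · B)` by a non-zero constant, and apply the row form.) [folklore] -/
theorem rank_hess0_trace_adjugate_mul_le {m : ℕ} (A B : Matrix (Fin m) (Fin m) (MvPolynomial σ K))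
    (hA : ∀ i j, (A i j).totalDegree ≤ 1) (hB : ∀ i j, (B i j).totalDegree ≤ 1)
    (hdet : constantCoeff A.det = 0) (h0 : constantCoeff (A.adjugate * B).trace = 0) :
    (hess0 (A.adjugate * B).trace).rank ≤ 4 * m := by
  classical
  cases m with
  | zero =>
      exfalso
      rw [Matrix.det_isEmpty, map_one] at hdet
      exact one_ne_zero hdet
  | succ n =>
    set Λ : Matrix (Fin (n + 1)) (Fin (n + 1)) K := A.map constantCoeff with hΛ
    have hΛdet : Λ.det = 0 := by
      rw [hΛ, ← RingHom.mapMatrix_apply, ← RingHom.map_det, hdet]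
    obtain ⟨c, hc0, hcΛ⟩ := Matrix.exists_vecMul_eq_zero_iff.mpr hΛdet
    obtain ⟨i₀, hi₀⟩ := Function.ne_iff.mp hc0
    set V : Matrix (Fin (n + 1)) (Fin (n + 1)) K := (1 : Matrix _ _ K).updateRow i₀ c with hV
    have hVdet : V.det = c i₀ := by
      have hc : c = ∑ l, c l • (1 : Matrix (Fin (n + 1)) (Fin (n + 1)) K) l := by
        ext j
        simp [Finset.sum_apply, Matrix.one_apply]
      rw [hV]
      conv_lhs => rw [hc]
      rw [Matrix.det_updateRow_sum, Matrix.det_one, smul_eq_mul, mul_one]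
    set VC : Matrix (Fin (n + 1)) (Fin (n + 1)) (MvPolynomial σ K) :=
      V.map (C : K →+* MvPolynomial σ K) with hVC
    have hVCdet : VC.det = C V.det := by
      rw [hVC, ← RingHom.mapMatrix_apply, ← RingHom.map_det]
    -- affineness is preserved by a constant left factor
    have hdegmul : ∀ (M : Matrix (Fin (n + 1)) (Fin (n + 1)) (MvPolynomial σ K)),
        (∀ i j, (M i j).totalDegree ≤ 1) → ∀ i j, ((VC * M) i j).totalDegree ≤ 1 := by
      intro M hM i j
      rw [Matrix.mul_apply]
      refine totalDegree_finsetSum_le fun l _ => ?_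
      rw [hVC, Matrix.map_apply]
      refine (totalDegree_mul _ _).trans ?_
      rw [totalDegree_C, zero_add]
      exact hM l j
    have hrow : ∀ j, constantCoeff ((VC * A) i₀ j) = 0 := by
      intro j
      have h := congrFun hcΛ j
      change ∑ l, c l * Λ l j = 0 at h
      rw [Matrix.mul_apply, map_sum]
      simp only [hVC, Matrix.map_apply, map_mul, constantCoeff_C, hV, Matrix.updateRow_self]
      simpa [hΛ] using h
    have htr : ((VC * A).adjugate * (VC * B)).trace = C V.det * (A.adjugate * B).trace := by
      rw [trace_adjugate_mul_mul_left, hVCdet]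
    have h0' : constantCoeff ((VC * A).adjugate * (VC * B)).trace = 0 := by
      rw [htr, map_mul, h0, mul_zero]
    have key := rank_hess0_trace_adjugate_mul_le_of_row (VC * A) (VC * B) i₀ (hdegmul A hA)
      (fun j => hdegmul B hB i₀ j) hrow h0'
    rwa [htr, hess0_C_mul, rank_smul_eq (by rw [hVdet]; exact hi₀)] at key

end Rank

end Summit.ValiantsHypothesis.ValiantsHypothesis.Theorems.GrenetZeonTwoDimCoefficients

end
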